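import Literature.MathematicalPhysics.QuantumFieldTheory.Balaban1983to89.B8Prop5NestedServerSrcPerBody
import Literature.MathematicalPhysics.QuantumFieldTheory.Balaban1983to89.B8Prop5NestedServerPer

/-!
# [B8] PROPOSITION 5 SERVED AT NESTED PERIODIC DOMAINS WITH THEOREM 8's SOURCE — pub-ymgap T5's guarded sockets `SP5` ∕ `SP5base` AS ∀-STATEMENTS over an
# index map `ι : J → ZdIdx d L` and a period map `p : J → ℕ`, THE BINDER TEXTS VERBATIM at instance (ii)
# `LanF a U₀ φ m W := LanF146 L (ι a).k (ι a).η ((ι a).Ω 0) (ι a).Λs U₀ φ m W`, `Φ := Site d → 𝔸`,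
# `Adm a φ U₀ α₀ α₁ := ((φ ∈ R(U₀) ∧ φ Hermitian ∧ φ = 0 off Ω₀ ∧ |φ|₍₋₂₎ finite) ∧ IsPeriodic (p a) φ) ∧ |φ|₍₋₂₎ < γ(α₀ + α₁)` — T6c's
# (`B8Thm8SurvivingZdGF3HP2PerMapLanEGammaGuarded` :107–:111) admissibility TEXT, token for token
# and `SH59 :=` T6c's SOURCED b9 SOCKET `SH59src` TEXT (:145–:170) over PRINT's class `towerBondsP L (ι a).Ω ((ι a).Λs m) ·`, token for token —
# EDITION γ′: the Λb-generic γ′ body instantiated at `towerBondsP` with `B8TowerBondsPrinted.ZdIdx.towerBondsP_laws (ι a)`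
# (B8-P5-NESTED-SERVER, existence instance (ii), layer E-ii-4b′ — the file n05-c's T6c successors knit against; r05 g96's E-ii-4b re-keyed by p21 g41)

statement-level skeleton of published theorems with citation tags; proofs where landed; nothing here is a claim about the Yang–Mills mass gap

Bałaban, *Comm. Math. Phys.* **99** (1985) 75–102 ([B8]; PDF page = printed page − 74): Prop. 5 (1.106)–(1.110) p. 94, Thm 4 p. 88 ∕ p. 95, Thm 8 (1.146)
p. 101, (1.66)–(1.69) p. 88, (1.29) p. 81, (1.31) + (1.35) p. 82, (1.57)–(1.59) p. 86, p. 77 («Ω_j ⊂ T_η»), p. 89 («k = 1 also»), §3 p. 98; [4] Thm 3.1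
p. 397, Thm 3.3 p. 399, (3.19) p. 393.  `[Balaban1985RegularSpaces]`; PDF held: `paper:balaban1985-cmp99-regular-spaces-gauge-fixing`.  STATUS: published, refereed.

CITATION HEADER (lean-in-tree rule).  Cell `lit-balaban`, seat `lit-balaban-p21` (g41) on r05 g96's hand-over (lit-balaban INBOX 2026-08-28T20:25:15Z «TAKE ALL THREE»);
pub-ymgap IR B8-P5-NESTED-SERVER (dag-n05-c, pub-ymgap INBOX l.41793), existence instance (ii).  WHY EDITION γ′: p21 g41's kernel FIT TEST (scratch concatenation of
r05's signed bytes + the consumer's binder texts cut from the tree; lit-balaban INBOX 20:20:49Z ∕ 20:25:09Z) showed (1) r05's first Adm display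
`((… ∧ Bdd) ∧ msup) ∧ IsPeriodic` ≠ T6c's `((… ∧ Bdd) ∧ IsPeriodic) ∧ msup` definitionally (fixed by r05 in the re-staged text used here), and (2) the consumer's
`SH59src` is stated over print's class `towerBondsP …` (T5 :164 ∕ :169, T6c :164 ∕ :169) while r05's `SH59` read the member's field `ZdIdx.Λb`: a free field, the
tree's `ZdIdx.lamB_subset_towerBondsP` runs the wrong way for an upper-bound hypothesis, and a body asking `hbox` at `Ω j` cannot be instantiated at `towerBondsP`
(crossing bonds: box ⊂ Ω_{j−1} by definition).  Hence the γ′ road: storey E-ii-3′ `B8SockHFPRDSrcGammaPrimePer` (`grad_bound_of_datum_src_γ'`, `hbox` at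
`Ω (j - 1)`), body E-ii-4a′ `B8Prop5NestedServerSrcPerBody.sP5_body_of_join_src_γ'_per`, and THIS server, which instantiates the body at
`Λb := fun m j => towerBondsP L (ι a).Ω ((ι a).Λs m) j` with `(ZdIdx.towerBondsP_laws (ι a)).1 ∕ .2` and `htw a m` — T5 :219–:221's own device, and p21 g39's
`B8SockSP5uNestedSrcPer` :458–:464 (uniqueness half).  Text = r05's re-staged E-ii-4b (sha16 3c27a54861de23db) + dag-n05-w4's γ windows family `hwinγ`
(`B8SockSP5ProviderSrcGammaPrime.sp5_of_sockLettersRD_src_γ'` (v), at `B₈`) + the class substitution; the base theorem VERBATIM (no class, no b9 input).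

WHY THIS FILE.  Lead g33's WAKE-B8P5NestedServerExist, instance (ii) «Theorem-8 source» (T6c consumers): the periodic twin of dag-n05-w4's `ℤᵈ` providers
`B8SockSP5ProviderSrc(GammaPrime).sp5_of_sockLettersRD_src(_γ')` in the box-form (1.35) edition of T5's `ZdIdx` members, assembled exactly like this seat's
instance-(i) file `B8Prop5NestedServerPer` (p659564): at each `(a, α₀, α₁, U₀, U′, φ, m, datum)` read the [4] letters at `n := m + 1` (displayed supplier
`hLet`, as in instance (i)), the SOURCED windows family `hwin` ((1.103)∕(1.106) at `hE₂ + γ(α₀ + α₁)∕2`), convert the admissibility clause into the body's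
source data (`|φ|₍₋₂₎ < γ(α₀ + α₁)` ⇒ `Bd2 … φ (γ(α₀ + α₁))`, Hermitian, periodic, `R(U₀)` at the top level), convert T5's SOURCED b9 SOCKET `SH59src` (taken
as the hypothesis `SH59` at this `LanF` ∕ `Adm`, `|B₁|` over PRINT's class `towerBondsP L (ι a).Ω ((ι a).Λs m) ·` — T5's text) into the body's `SH59m` (datum bound `c⋆ ≤ 2Lc⋆ + 8α₄`,
`B₀ ≤ B₈` on the non-negative bracket, source terms `γ′B₀(α₀ + α₁)`), `c_DA = 2dL²c⋆ ≥ dL²(c⋆ + 2γ′B₀(α₀ + α₁))` from `2γ′B₀ ≤ 5dLB₈`, and call E-ii-4a's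
`sP5_body_of_join_src_γ'_per` (at `Λb := towerBondsP …`, laws `ZdIdx.towerBondsP_laws (ι a)`, γ windows from `hwinγ`) ∕ `sP5base_body_of_join_src_per`.  `LanF146 … k W ↔ IsLandau146W …` (`B8LanF146.lanF146_top_iff`) is T5's `hLanF`-type reading
at the top level.

WHAT THIS FILE PROVES (kernel, 0 sorry, theorems only): ★★★ `sockP5SrcPer_of_lettersAtPerNested` (T5 `SP5` :131–:149 ∕ T6c :123–:144 at instance (ii)), ★★★
`sockP5baseSrcPer_of_lettersAtPerNested` (T5 `SP5base` :117–:130 ∕ T6c :107–:122 at instance (ii)).  KNIT RECIPE (T6c's slots, `LanF := fun a U₀ φ m W => LanF146 …`):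
`SP5base := sockP5baseSrcPer_of_lettersAtPerNested hd2 hL hB₀' hB₈ hB₀'H hB₂' hBG hBR hγ.le ι p htw hdiv hΛ hΩp hB hLet hwin`,
`SP5 := sockP5SrcPer_of_lettersAtPerNested hd2 hL hB₀ hB₀' hB₈ hB₀'H hB₂' hBG hBR hγ.le hγ' hB₀8 hγB2 ι p htw hlt htop hdiv hΛ hΩp SH59src hLet hwin hwinγ`
(`hγB2 : 2 * (γ' * B₀) ≤ 5 * d * L * B₈`, implied by T6c's `hγB`; `SH59src` = T6c's own hypothesis, passed AS IS) — checked by `exact` in p21 g41's fit-test trailer.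

HONEST SCOPE ∕ A6.  By-name re-assembly; 0 new estimates.  [4]'s letters with their laws at nested periodic `Ω_j`, the sourced (1.59) lines (`SH59`) and the
windows are HYPOTHESES (N06 content at `m ≥ 1`; the sourced b9 lines over a «box ⊂ Ω_j» class are known false at some nested members on `ℤᵈ` — dag-n05-c
p572834 ∕ p576185, dag-n05-d p585094 — and are displayed, never discharged, here); no joint-satisfiability claim; `d ≥ 2`, `L ≥ 2`.  Count-neutral; N05 NOT
discharged by a server; `T_η` read as `P`-periodic data on `ηℤᵈ`; one finite `T⁴` programme at fixed `ε` — nothing continuum ∕ ℝ⁴ ∕ OS ∕ mass-gap ∕ Clay: the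
Yang–Mills mass gap is NOT proved here or by anything this file feeds.  No `sorry`, no `def`, no `instance`, no `notation`.
-/

noncomputable section

open NormedSpace
open scoped BigOperators

namespace Literature.MathematicalPhysics.QuantumFieldTheory.Balaban1983to89.B8Prop5NestedServerSrcPer

open B7Prop1Explicit B7Prop2Explicit B7Prop1Local B7Eq92Concrete
open B7Prop2Explicit (C0 c2')
open B7Prop3Flat (c3)
open B7Prop10General (C6 C4G)
open B7Prop9Flat (C5')
open B7Eq78Linearization (zdBlocking QprimeIter)
open B8Ineq130 (tlo thi)
open B8Ineq132 (covDerivFwd InAk)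
open B8Eq119TwistedAxial (Restr129 InAx bgT)
open B8Eq184Proof (gaugeExp cfgExp)
open B8Lemma1NonAbelian (mulCfg)
open B8Eq140Level (SideTouches)
open B8Eq138LandauZd (IsLandau138W InR138 covLap QT)
open B8Ineq125Concrete (C2p)
open B8Eq1117Concrete (XSpace)
open B8Prop5ContractionKLevel (Bd2 Mc Kc)
open B8LambdaSpaceKLevel (wt)
open B8LeafModelZd (ZdIdx)
open B8Prop5NestedServerSrcPerBody (sP5_body_of_join_src_γ'_per sP5base_body_of_join_src_per)
open B8TowerBondsPrinted (towerBondsP)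
open B8LanF146 (LanF146)
open B8Eq184Proof (cfgExp)
open B8Eq155JBound (Jcur wsup wsup_nonneg)
open B7Prop4GeneralLevels (linCovIter)
open B8ScaledSupNorm (bondNorm msup Bdd msup_nonneg weight_mul_norm_le_msup weight_neg_natCast)
open B8Eq146AExpansion (iEta)
open QuantumLattice (blockSites)
open T4TermwiseTorus (IsPeriodic)

-- `Site` alone could resolve to the torus sites of `Setup.lean`; re-export the `ℤ^d` sites of `B7Prop1Explicit`.
export B7Prop1Explicit (Site)

variable {d : ℕ}

section Sockets

variable {𝔸 : Type*} [CStarAlgebra 𝔸] [Nontrivial 𝔸]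

/-- ★★★ **pub-ymgap T5's GUARDED SOCKET `SP5` :131–:149 (PROPOSITION 5, EXISTENCE AT LEVEL `m + 1`, PERIODIC ARGUMENTS, NESTED `P`-PERIODIC MEMBERS) —
THE BINDER TEXT VERBATIM at instance (ii) `LanF a U₀ φ m W := LanF146 L (ι a).k (ι a).η ((ι a).Ω 0) (ι a).Λs U₀ φ m W`, `Φ := Site d → 𝔸`,
`Adm a φ U₀ α₀ α₁ :=` T6c's admissibility `((ℤᵈ Thm-8 admissibility ∧ IsPeriodic (p a) φ) ∧ |φ|₍₋₂₎ < γ(α₀ + α₁))`** (the premiss displayed β-reduced, T6c :107–:111 token for token), over an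
index map `ι : J → ZdIdx d L` and a period map `p : J → ℕ`, FROM: the per-member laws (towers at every truncation, truncation relations, `Lʲ ∣ p a`,
`Λ_j^{(m)}` shift-invariant, `Ω_j` `(p a)`-periodic), T5's SOURCED b9 socket `SH59src` at this `LanF` ∕ `Adm` (hypothesis `SH59`), ONE DISPLAYED SUPPLIER `hLet` of the [4]
letters at `((ι a), n, U₀)` for every periodic unitary `U₀ ∈ 𝔄_k({Ω_j}, α₀)` and every truncation `1 ≤ n ≤ k` (linear maps `G′, Δ↾Ω₀, Q′, Q′ᵀ𝔄, 𝔄, C, H′` with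
(E1) ∕ (E2) ∕ (1.91) at periodic arguments, the readings, the `H′` ∕ `G′` ∕ remainder laws, (P) — the module docstring of FILE 1 lists them), and the JOIN's
scalar windows `hwin` below the threshold `cP` (the shape of `B8Thm2TorusServerPer.sockP5Step_of_lettersAtPer`'s, remainder constant `B_R` as supplied).
PROOF: at each `(a, α₀, α₁, U₀, U′, m, datum)` read the letters at `n := m + 1`, the windows `hwin` and the γ windows `hwinγ`, and call E-ii-4a′'s
`sP5_body_of_join_src_γ'_per` at `Λb := towerBondsP L (ι a).Ω ((ι a).Λs m) ·` with `B8TowerBondsPrinted.ZdIdx.towerBondsP_laws (ι a)` and `htw a m`.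
[cite: Balaban1985RegularSpaces, Prop. 5 (1.107)–(1.108) p.94, Thm 4 p.88, Thm 8 (1.146) p.101, (1.57)–(1.59) p.86, (1.68)–(1.69) p.88, (1.29) p.81, p.77 («Ω_j ⊂ T_η»); Balaban1985BackgroundPropagators, Thm 3.1 p.397, Thm 3.3 p.399, (3.19) p.393] -/
theorem sockP5SrcPer_of_lettersAtPerNested (hd2 : 2 ≤ d) {L : ℕ} (hL : 2 ≤ L)
    {B₀ B₀' B₈ cP γ γ' B₀'H B₂' BG BR : ℝ}
    (hB₀ : 0 < B₀) (hB₀' : 0 < B₀') (hB₈ : 0 < B₈) (hB₀'H : 0 < B₀'H) (hB₂' : 0 ≤ B₂') (hBG : 0 ≤ BG) (hBR : 0 ≤ BR)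
    (hγ : 0 ≤ γ) (hγ' : 0 ≤ γ') (hB₀8 : B₀ ≤ B₈) (hγB : 2 * (γ' * B₀) ≤ 5 * (d : ℝ) * L * B₈)
    {J : Type*} (ι : J → ZdIdx d L) (p : J → ℕ)
    -- PER-MEMBER LAWS (displayed): towers «Bʲ(y) ⊂ Ω_j» at every truncation, the truncation relations of the families `Λs m` ∕ `Λs (m+1)`,
    -- the torus data `Lʲ ∣ P`, `Λ_j^{(m)}` shift-invariant, `Ω_j` `P`-periodic (print's «Ω_j ⊂ T_η», p. 77)
    (htw : ∀ a : J, ∀ m, m ≤ (ι a).k → ∀ j, j ≤ m → ∀ y ∈ (ι a).Λs m j, ∀ x, InBox (tlo L y j) (thi L y j) x → x ∈ (ι a).Ω j)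
    (hlt : ∀ a : J, ∀ m, m < (ι a).k → ∀ j, j < m → (ι a).Λs m j = (ι a).Λs (m + 1) j)
    (htop : ∀ a : J, ∀ m, m < (ι a).k → ∀ x, x ∈ (ι a).Λs m m ↔ x ∈ (ι a).Λs (m + 1) m ∨ ∃ y ∈ (ι a).Λs (m + 1) (m + 1), x ∈ blockSites L y)
    (hdiv : ∀ a : J, ∀ j, j ≤ (ι a).k → ((L : ℤ) ^ j ∣ (p a : ℤ)))
    (hΛ : ∀ a : J, ∀ m, m ≤ (ι a).k → ∀ j, j ≤ m → ∀ (y : Site d) (i : Fin d),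
      y + ((p a : ℤ) / (L : ℤ) ^ j) • e i ∈ (ι a).Λs m j ↔ y ∈ (ι a).Λs m j)
    (hΩp : ∀ a : J, ∀ j, j ≤ (ι a).k → IsPeriodic (p a) (fun x : Site d => x ∈ (ι a).Ω j))
    -- T5's SOURCED b9 SOCKET `SH59src` :150–:173 AT THIS `LanF` ∕ `Adm` ([4] Thm 3.3 + (1.57)–(1.58) with source, `+ γ′B₀(α₀ + α₁)`, periodic
    -- `(u, W, A′)`; `|B₁|` over PRINT's class `towerBondsP L (ι a).Ω ((ι a).Λs m) ·` — T5 :150–:170 ∕ T6c :145–:170 TEXT, token for token)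
    (SH59 : ∀ a : J, ∀ α₀ α₁ : ℝ, 0 < α₀ → 0 < α₁ → α₀ + α₁ ≤ cP →
      ∀ U₀ U' : Site d → Fin d → 𝔸ˣ, (∀ x κ, U₀ x κ ∈ unitaryUnits 𝔸) → (∀ x κ, U' x κ ∈ unitaryUnits 𝔸) →
      IsPeriodic (p a) U₀ → IsPeriodic (p a) U' → ∀ φ : Site d → 𝔸, (((InR138 L (ι a).k (ι a).η ((ι a).Ω 0) ((ι a).Λs (ι a).k) U₀ φ ∧ (∀ x, IsSelfAdjoint (φ x)) ∧ (∀ x, x ∉ (ι a).Ω 0 → φ x = 0) ∧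
          Bdd L (ι a).k (ι a).η (-(2 : ℝ)) (fun j (x : Site d) => x ∈ (ι a).Ω j) φ) ∧ IsPeriodic (p a) φ) ∧
        msup L (ι a).k (ι a).η (-(2 : ℝ)) (fun j (x : Site d) => x ∈ (ι a).Ω j) φ < γ * (α₀ + α₁)) →
      InAk L (ι a).k (ι a).η α₀ (ι a).Ω U₀ → InAk L (ι a).k (ι a).η α₀ (ι a).Ω (mulCfg U' U₀) → (∀ m, m ≤ (ι a).k → InAx L m ((ι a).Λs m) U₀ (mulCfg U' U₀)) →
      (∀ j, j ≤ (ι a).k → ∀ (z : Site d) (μ : Fin d),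
        ((∀ x, InBox (tlo L z j) (thi L z j) x → x ∈ (ι a).Ω j) ∨ (∀ x, InBox (tlo L (z + e μ) j) (thi L (z + e μ) j) x → x ∈ (ι a).Ω j)) →
        ‖(avgIter L (mulCfg U' U₀) j z μ : 𝔸) - (avgIter L U₀ j z μ : 𝔸)‖ ≤ α₁) →
      (∀ b ∈ {b : Site d × Fin d | SideTouches ((ι a).Ω 0) b.1 b.2}, ‖((U' b.1 b.2 : 𝔸ˣ) : 𝔸) - 1‖ ≤ α₁) →
      (∀ m, 1 ≤ m → m ≤ (ι a).k → ∀ (u : Site d → 𝔸ˣ) (W : Site d → Fin d → 𝔸ˣ) (A' : Site d → Fin d → 𝔸),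
        (∀ x, u x ∈ unitaryUnits 𝔸) → IsPeriodic (p a) u → IsPeriodic (p a) W → IsPeriodic (p a) A' →
        mgauge U₀ u W = U' → Restr129 L m ((ι a).Λs m) U₀ u → LanF146 L (ι a).k (ι a).η ((ι a).Ω 0) (ι a).Λs U₀ φ m W →
        (∀ y τ, IsSelfAdjoint (A' y τ)) →
        (∀ j, j ≤ m → ∀ y τ, SideTouches ((ι a).Ω j) y τ →
        W y τ = cfgExp (ι a).η A' y τ ∧ ‖A' y τ‖ ≤ (2 * (L * (5 * (d : ℝ) * L * B₈ * (α₀ + α₁))) + 8 * (8 * B₀' * (5 * (d : ℝ) * L * B₈) * (α₀ + α₁))) * ((L : ℝ) ^ j * (ι a).η)⁻¹) →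
        (∀ y τ, (∀ j, j ≤ m → ¬ SideTouches ((ι a).Ω j) y τ) → A' y τ = 0) →
        msup L m (ι a).η (-(1 : ℝ)) (fun j (b : Site d × Fin d) => SideTouches ((ι a).Ω j) b.1 b.2) (fun b => A' b.1 b.2)
        ≤ B₀ * (bondNorm L m (ι a).η (-(3 : ℝ)) (ι a).Ω (fun x μ => Jcur (ι a).η U₀ A' μ x)
        + wsup 1 (fun p : {p : ℕ × (Site d × Fin d) // p.1 ≤ m ∧ p.2 ∈ towerBondsP L (ι a).Ω ((ι a).Λs m) p.1} =>
        linCovIter L U₀ (iEta (ι a).η A') p.1.1 p.1.2.1 p.1.2.2)) + γ' * B₀ * (α₀ + α₁) ∧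
        msup L m (ι a).η (-(2 : ℝ)) (fun j (t : Fin d × Fin d × Site d) => SideTouches ((ι a).Ω j) t.2.2 t.2.1)
        (fun t => covDerivFwd (ι a).η U₀ t.1 (fun z => A' z t.2.1) t.2.2)
        ≤ B₀ * (bondNorm L m (ι a).η (-(3 : ℝ)) (ι a).Ω (fun x μ => Jcur (ι a).η U₀ A' μ x)
        + wsup 1 (fun p : {p : ℕ × (Site d × Fin d) // p.1 ≤ m ∧ p.2 ∈ towerBondsP L (ι a).Ω ((ι a).Λs m) p.1} =>
        linCovIter L U₀ (iEta (ι a).η A') p.1.1 p.1.2.1 p.1.2.2)) + γ' * B₀ * (α₀ + α₁)))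
    -- THE [4] LETTERS AT NESTED `Ω_j` (displayed supplier; N06's periodic Green's-function line)
    (hLet : ∀ a : J, ∀ α₀ : ℝ, 0 < α₀ → ∀ U₀ : Site d → Fin d → 𝔸ˣ, (∀ x κ, U₀ x κ ∈ unitaryUnits 𝔸) → IsPeriodic (p a) U₀ →
      InAk L (ι a).k (ι a).η α₀ (ι a).Ω U₀ → ∀ n, 1 ≤ n → n ≤ (ι a).k →
      ∃ (g Δ : (Site d → 𝔸) →ₗ[ℂ] (Site d → 𝔸)) (q : (Site d → 𝔸) →ₗ[ℂ] (ℕ → Site d → 𝔸)) (qs : (ℕ → Site d → 𝔸) →ₗ[ℂ] (Site d → 𝔸))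
        (Aw c : (ℕ → Site d → 𝔸) →ₗ[ℂ] (ℕ → Site d → 𝔸)) (H' : XSpace d n 𝔸 →ₗ[ℂ] (Site d → 𝔸)),
        (∀ x, (∀ (z : Site d) (i : Fin d), x (z + (p a : ℤ) • e i) = x z) → ∀ y ∈ (ι a).Ω 0, (Δ (g x) + qs (Aw (q (g x)))) y = x y) ∧
        (∀ f, (∀ (z : Site d) (i : Fin d), f (z + (p a : ℤ) • e i) = f z) → q (g (g (qs (c (q f))))) = q f) ∧
        (∀ (f : Site d → 𝔸) (z : Site d) (i : Fin d), g f (z + (p a : ℤ) • e i) = g f z) ∧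
        (∀ f : Site d → 𝔸, (∀ (z : Site d) (i : Fin d), f (z + (p a : ℤ) • e i) = f z) →
      ∀ (z : Site d) (i : Fin d), qs (c (q f)) (z + (p a : ℤ) • e i) = qs (c (q f)) z) ∧
        (∀ (f : Site d → 𝔸), ∀ x ∈ (ι a).Ω 0, Δ f x = covLap (ι a).η U₀ (((ι a).Ω 0).indicator f) x) ∧
        (∀ (μ : ℕ → Site d → 𝔸), ∀ x ∈ (ι a).Ω 0, qs μ x = QT L n ((ι a).Λs n) U₀ μ x) ∧
        (∀ (f : Site d → 𝔸) (j : ℕ), j ≤ n → ∀ y ∈ (ι a).Λs n j, q f j y = QprimeIter (zdBlocking d L) (bgT L U₀) j f y) ∧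
        (∀ (X : XSpace d n 𝔸) (x : Site d), ‖H' X x‖ ≤ B₀'H * ‖X‖) ∧
        (∀ j, j ≤ n → ∀ (X : XSpace d n 𝔸), ∀ b ∈ {b : Site d × Fin d | SideTouches ((ι a).Ω j) b.1 b.2},
      wt L (ι a).η j * ‖covDerivFwd (ι a).η U₀ b.2 (H' X) b.1‖ ≤ B₀'H * ‖X‖) ∧
        (∀ X : XSpace d n 𝔸, Bd2 L (ι a).η n (ι a).Ω (covLap (ι a).η U₀ (H' X)) (B₂' * ‖X‖)) ∧
        (∀ (X : XSpace d n 𝔸) (x : Site d), x ∉ (ι a).Ω 0 → H' X x = 0) ∧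
        (∀ X Y : XSpace d n 𝔸, (∀ b, Y b = -star (X b)) → ∀ x, H' Y x = -star (H' X x)) ∧
        (∀ X : XSpace d n 𝔸, (∀ (b : Fin (n + 1) × Site d) (i : Fin d), X (b.1, b.2 + ((p a : ℤ) / (L : ℤ) ^ (b.1 : ℕ)) • e i) = X b) →
      ∀ (z : Site d) (i : Fin d), H' X (z + (p a : ℤ) • e i) = H' X z) ∧
        (∀ (Y : XSpace d n 𝔸), (∀ (b : Fin (n + 1) × Site d) (i : Fin d), Y (b.1, b.2 + ((p a : ℤ) / (L : ℤ) ^ (b.1 : ℕ)) • e i) = Y b) →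
      ∀ (j : ℕ) (hj : j ≤ n) (y : Site d), y ∈ (ι a).Λs n j →
      QprimeIter (zdBlocking d L) (bgT L U₀) j (H' Y) y = Y (⟨j, Nat.lt_succ_of_le hj⟩, y)) ∧
        (∀ (f : Site d → 𝔸) (r : ℝ), 0 ≤ r → Bd2 L (ι a).η n (ι a).Ω f r →
      (∀ x, ‖g f x‖ ≤ BG * r) ∧ ∀ j, j ≤ n → ∀ b ∈ {b : Site d × Fin d | SideTouches ((ι a).Ω j) b.1 b.2},
        wt L (ι a).η j * ‖covDerivFwd (ι a).η U₀ b.2 (g f) b.1‖ ≤ BG * r) ∧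
        (∀ (f : Site d → 𝔸) (x : Site d), x ∉ (ι a).Ω 0 → g f x = 0) ∧
        (∀ f : Site d → 𝔸, (∀ j, j ≤ n → ∀ x ∈ (ι a).Ω j, IsSelfAdjoint (f x)) → ∀ x, IsSelfAdjoint (g f x)) ∧
        (∀ (f : Site d → 𝔸) (r : ℝ), 0 ≤ r → Bd2 L (ι a).η n (ι a).Ω f r → Bd2 L (ι a).η n (ι a).Ω (f - g (qs (c (q (g f))))) (BR * r)) ∧
        (∀ f : Site d → 𝔸, (∀ j, j ≤ n → ∀ x ∈ (ι a).Ω j, IsSelfAdjoint (f x)) →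
      ∀ j, j ≤ n → ∀ x ∈ (ι a).Ω j, IsSelfAdjoint ((f - g (qs (c (q (g f))))) x)))
    -- THE JOIN's SCALAR WINDOWS BELOW `cP`, SOURCED (displayed; `c⋆ = 5dLB₈(α₀+α₁)`, `α₄ = 8B₀′(5dLB₈)(α₀+α₁)`, `c_B = c_A = L·c⋆`, `c_DA = 2dL²c⋆`,
    -- (1.103)∕(1.106) at `hE₂ + γ(α₀ + α₁)∕2`)
    (hwin : ∀ α₀ α₁ : ℝ, 0 < α₀ → 0 < α₁ → α₀ + α₁ ≤ cP → ∀ cs α₄ cB cDA hE hE₂ lE lE₂ : ℝ,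
      cs = 5 * (d : ℝ) * L * B₈ * (α₀ + α₁) → α₄ = 8 * B₀' * (5 * (d : ℝ) * L * B₈) * (α₀ + α₁) →
      cB = L * cs → cDA = 2 * (d : ℝ) * (L : ℝ) ^ 2 * cs →
      hE = B₀'H * (C2p d * (40 * d * cB + α₄) * α₄) → hE₂ = B₂' * (C2p d * (40 * d * cB + α₄) * α₄) →
      lE = B₀'H * (4 * C2p d * (40 * d * cB + 2 * α₄)) → lE₂ = B₂' * (4 * C2p d * (40 * d * cB + 2 * α₄)) →
      36 * d * B₈ * cs ≤ 1 / 2 ∧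
      8 * (131072 * ((d : ℝ) + 1) ^ 2) * Real.exp (4 * (800 * ((d : ℝ) + 1) ^ 2 * ((d : ℝ) + 4)) * α₀) ≤ 16 * (131072 * ((d : ℝ) + 1) ^ 2) ∧
      2 * cs ^ 2 + 20 * d * α₀ * cs + 2 * (16 * (131072 * ((d : ℝ) + 1) ^ 2)) * cs ^ 2 ≤ α₀ + α₁ ∧
      (d : ℝ) * L * α₁ ≤ 1 / 8 ∧
      C0 d * α₀ ≤ 1 / 3 ∧ 4 * α₀ ≤ c2' d L ∧
      Real.exp (4 * (800 * ((d : ℝ) + 1) ^ 2 * ((d : ℝ) + 4)) * α₀) * (1 + 8 * (131072 * ((d : ℝ) + 1) ^ 2) * cB) ≤ 2 ∧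
      2 * cB ≤ c3 d L ∧ 2048 * (d : ℝ) * cB ≤ 1 ∧ 40 * d * cB ≤ 1 / 200 ∧
      200 * C6 d * (2 * α₄) ≤ 1 ∧ 12000 * ((d : ℝ) + 1) * L * (2 * α₄) ≤ 1 ∧
      C4G d L * (α₀ + 40 * d * cB + 4 * (2 * α₄)) ≤ 1 ∧
      1024 * ((d : ℝ) + 1) * ((d : ℝ) + 4) * L ^ 2 * α₀ ≤ 1 ∧ 32 * ((d : ℝ) + 1) ^ 2 * C6 d * L ^ 2 * α₀ ≤ 1 ∧
      16 * d * C5' d * C6 d * (L : ℝ) ^ 2 * α₀ ≤ 1 ∧ 8 * d * C6 d * L * α₀ ≤ 1 ∧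
      40 * d * cB + α₄ ≤ 1 / (4 * B₀'H * (2 * C2p d)) ∧ 2 * C6 d * (40 * d * cB + 4 * α₄) ≤ 1 / 8 ∧
      cB ≤ 1 / 13 ∧ α₄ / 4 + hE ≤ 1 / 24 ∧ α₄ / 4 + hE ≤ 1 / 140 ∧ 10 * (α₄ / 4 + hE) * BR ≤ 1 / 2 ∧
      BG * Mc d BR (α₄ / 4 + hE) cB (hE₂ + γ * (α₀ + α₁) / 2) cDA ≤ α₄ / 4 ∧
      BG * Kc d BR (α₄ / 4 + hE) cB (hE₂ + γ * (α₀ + α₁) / 2) cDA lE₂ (1 + lE) (1 + lE) ≤ 1 / 2)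
    -- EDITION γ′: the γ windows family below `c_P` (dag-n05-w4's `B8SockSP5ProviderSrcGammaPrime.sp5_of_sockLettersRD_src_γ'` (v) text, at `B₈`):
    -- [3] Prop. 4's windows one level lower at `(L²α₀, c_B)`, the L²-scaled (1.56) constant `C₂ = 16·131072(d+1)²·L²` and its (1.61)
    (hwinγ : ∀ α₀ α₁ : ℝ, 0 < α₀ → 0 < α₁ → α₀ + α₁ ≤ cP →
      ∀ cs cB : ℝ, cs = 5 * (d : ℝ) * L * B₈ * (α₀ + α₁) → cB = L * cs →
      C0 d * ((L : ℝ) ^ 2 * α₀) ≤ 1 / 3 ∧ 4 * ((L : ℝ) ^ 2 * α₀) ≤ c2' d L ∧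
      Real.exp (4 * (800 * ((d : ℝ) + 1) ^ 2 * ((d : ℝ) + 4)) * ((L : ℝ) ^ 2 * α₀)) * (1 + 8 * (131072 * ((d : ℝ) + 1) ^ 2) * cB) ≤ 2 ∧
      8 * (131072 * ((d : ℝ) + 1) ^ 2) * Real.exp (4 * (800 * ((d : ℝ) + 1) ^ 2 * ((d : ℝ) + 4)) * ((L : ℝ) ^ 2 * α₀)) * (L : ℝ) ^ 2
        ≤ 16 * (131072 * ((d : ℝ) + 1) ^ 2) * (L : ℝ) ^ 2 ∧
      2 * cs ^ 2 + 20 * d * α₀ * cs + 2 * (16 * (131072 * ((d : ℝ) + 1) ^ 2) * (L : ℝ) ^ 2) * cs ^ 2 ≤ α₀ + α₁) :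
    ∀ a : J, ∀ α₀ α₁ : ℝ, 0 < α₀ → 0 < α₁ → α₀ + α₁ ≤ cP →
      ∀ U₀ U' : Site d → Fin d → 𝔸ˣ, (∀ x κ, U₀ x κ ∈ unitaryUnits 𝔸) → (∀ x κ, U' x κ ∈ unitaryUnits 𝔸) →
      IsPeriodic (p a) U₀ → IsPeriodic (p a) U' → ∀ φ : Site d → 𝔸, (((InR138 L (ι a).k (ι a).η ((ι a).Ω 0) ((ι a).Λs (ι a).k) U₀ φ ∧ (∀ x, IsSelfAdjoint (φ x)) ∧ (∀ x, x ∉ (ι a).Ω 0 → φ x = 0) ∧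
          Bdd L (ι a).k (ι a).η (-(2 : ℝ)) (fun j (x : Site d) => x ∈ (ι a).Ω j) φ) ∧ IsPeriodic (p a) φ) ∧
        msup L (ι a).k (ι a).η (-(2 : ℝ)) (fun j (x : Site d) => x ∈ (ι a).Ω j) φ < γ * (α₀ + α₁)) →
      InAk L (ι a).k (ι a).η α₀ (ι a).Ω U₀ → InAk L (ι a).k (ι a).η α₀ (ι a).Ω (mulCfg U' U₀) → (∀ m, m ≤ (ι a).k → InAx L m ((ι a).Λs m) U₀ (mulCfg U' U₀)) →
      (∀ j, j ≤ (ι a).k → ∀ (z : Site d) (μ : Fin d),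
        ((∀ x, InBox (tlo L z j) (thi L z j) x → x ∈ (ι a).Ω j) ∨ (∀ x, InBox (tlo L (z + e μ) j) (thi L (z + e μ) j) x → x ∈ (ι a).Ω j)) →
        ‖(avgIter L (mulCfg U' U₀) j z μ : 𝔸) - (avgIter L U₀ j z μ : 𝔸)‖ ≤ α₁) →
      (∀ b ∈ {b : Site d × Fin d | SideTouches ((ι a).Ω 0) b.1 b.2}, ‖((U' b.1 b.2 : 𝔸ˣ) : 𝔸) - 1‖ ≤ α₁) →
      (∀ m, 1 ≤ m → m < (ι a).k → ∀ (u₁ : Site d → 𝔸ˣ) (U₁ : Site d → Fin d → 𝔸ˣ) (A : Site d → Fin d → 𝔸),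
        (∀ x, u₁ x ∈ unitaryUnits 𝔸) → (∀ x, x ∉ (ι a).Ω 0 → u₁ x = 1) → IsPeriodic (p a) u₁ → IsPeriodic (p a) U₁ → IsPeriodic (p a) A →
        mgauge U₀ u₁ U₁ = U' → Restr129 L m ((ι a).Λs m) U₀ u₁ → LanF146 L (ι a).k (ι a).η ((ι a).Ω 0) (ι a).Λs U₀ φ m U₁ →
        (∀ j, j ≤ m → ∀ b ∈ {b : Site d × Fin d | SideTouches ((ι a).Ω j) b.1 b.2},
        U₁ b.1 b.2 = cfgExp (ι a).η A b.1 b.2 ∧ IsSelfAdjoint (A b.1 b.2) ∧ ‖A b.1 b.2‖ ≤ (5 * (d : ℝ) * L * B₈ * (α₀ + α₁)) * ((L : ℝ) ^ j * (ι a).η)⁻¹) →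
        ∃ (v : Site d → 𝔸ˣ) (lam : Site d → 𝔸), (∀ x, v x ∈ unitaryUnits 𝔸) ∧ (∀ x, x ∉ (ι a).Ω 0 → v x = 1) ∧
        (∀ j, j ≤ m + 1 → ∀ b ∈ {b : Site d × Fin d | SideTouches ((ι a).Ω j) b.1 b.2}, (v b.1 : 𝔸) = ((gaugeExp lam b.1 : 𝔸ˣ) : 𝔸) ∧
        (v (b.1 + e b.2) : 𝔸) = ((gaugeExp lam (b.1 + e b.2) : 𝔸ˣ) : 𝔸)) ∧
        (∀ j, j ≤ m + 1 → ∀ b ∈ {b : Site d × Fin d | SideTouches ((ι a).Ω j) b.1 b.2},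
        ‖lam b.1‖ ≤ (8 * B₀' * (5 * (d : ℝ) * L * B₈) * (α₀ + α₁)) ∧ ((L : ℝ) ^ j * (ι a).η) * ‖covDerivFwd (ι a).η U₀ b.2 lam b.1‖ ≤ (8 * B₀' * (5 * (d : ℝ) * L * B₈) * (α₀ + α₁))) ∧
        LanF146 L (ι a).k (ι a).η ((ι a).Ω 0) (ι a).Λs U₀ φ (m + 1) (mgauge U₀ v⁻¹ U₁) ∧ Restr129 L (m + 1) ((ι a).Λs (m + 1)) U₀ (u₁ * v) ∧
        IsPeriodic (p a) v) := by
  intro a α₀ α₁ hα₀ hα₁ hs U₀ U' hU₀ hU' hU₀p hU'p φ hAdm h33 h34 hAx h135 h66 m hm1 hmk u₁ U₁ A hu₁ _hsupp hu₁p hU₁p hAp hW h129 hLan hdat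
  obtain ⟨⟨⟨hInR, hφsa, hφoff, hBdd⟩, hφp⟩, hφn⟩ := hAdm
  obtain ⟨g, Δ, q, qs, Aw, c, H', g_rightΩ, c_range, hGper, hqcq_per, hΔ, hqs, hq, hH0, hH1, hH2, hHsupp, hHequiv, hHper, hQH, hG, hGsupp, hGreal, hRbd, hRreal⟩ :=
    hLet a α₀ hα₀ U₀ hU₀ hU₀p h33 (m + 1) (by omega) hmk
  obtain ⟨hside, -, -, hsmall₁, hα3, hα4, hsmall, hc₃, hsc, hα₃', hs₁, hs₂, hs₃, hs₄, hs₅, hs₆, hs₇, hsm, hprod8, hcA', ha₁', hb₁', hθ, h103, h106⟩ :=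
    hwin α₀ α₁ hα₀ hα₁ hs _ _ _ _ _ _ _ _ rfl rfl rfl rfl rfl rfl rfl rfl
  -- the γ windows at this (α₀, α₁) (the (1.56)-constant line and (1.61) are the γ ones)
  obtain ⟨hα3L, hα4L, hsmallL, hC₂L, h61L⟩ := hwinγ α₀ α₁ hα₀ hα₁ hs _ _ rfl rfl
  have hLr : (1 : ℝ) ≤ L := by exact_mod_cast (show 1 ≤ L by omega)
  have hηa : 0 < (ι a).η := (ι a).hη
  have hsum : 0 < α₀ + α₁ := add_pos hα₀ hα₁
  have hcs0 : 0 ≤ 5 * (d : ℝ) * L * B₈ * (α₀ + α₁) := by positivity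
  -- the source: size `γ(α₀ + α₁)` on the `Ω_j`, `j ≤ m + 1` (from the `Bdd` clause and the norm premiss of the admissibility), Hermitian, periodic
  have hmf : 0 ≤ γ * (α₀ + α₁) := by positivity
  have hf : Bd2 L (ι a).η (m + 1) (ι a).Ω φ (γ * (α₀ + α₁)) := by
    intro j hj x hx
    have h := weight_mul_norm_le_msup hBdd (hj.trans (Nat.succ_le_of_lt hmk)) (i := x) hx
    have e2 : (-(2 : ℝ)) = -((2 : ℕ) : ℝ) := by norm_num
    rw [e2, weight_neg_natCast L (ι a).η 2 j] at h
    have hw : wt L (ι a).η j ^ 2 = ((L : ℝ) ^ j * (ι a).η) ^ 2 := rfl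
    rw [hw]
    rw [e2] at hφn
    exact h.trans hφn.le
  have hfsa : ∀ j, j ≤ m + 1 → ∀ x ∈ (ι a).Ω j, IsSelfAdjoint (φ x) := fun _ _ x _ => hφsa x
  -- the SOURCED b9 lines at the datum, from `SH59` at level `m` (`B₀ ≤ B₈` on the non-negative bracket; `c⋆ ≤ 2Lc⋆ + 8α₄` on the datum bound)
  have hSg : 0 ≤ γ' * B₀ * (α₀ + α₁) := by positivity
  have SH59m : ∀ A' : Site d → Fin d → 𝔸, IsPeriodic (p a) A' → (∀ y τ, IsSelfAdjoint (A' y τ)) →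
      (∀ j, j ≤ m → ∀ (y : Site d) (τ : Fin d), SideTouches ((ι a).Ω j) y τ →
        U₁ y τ = cfgExp (ι a).η A' y τ ∧ ‖A' y τ‖ ≤ (5 * (d : ℝ) * L * B₈ * (α₀ + α₁)) * ((L : ℝ) ^ j * (ι a).η)⁻¹) →
      (∀ (y : Site d) (τ : Fin d), (∀ j, j ≤ m → ¬ SideTouches ((ι a).Ω j) y τ) → A' y τ = 0) →
      msup L m (ι a).η (-(1 : ℝ)) (fun j (b : Site d × Fin d) => SideTouches ((ι a).Ω j) b.1 b.2) (fun b => A' b.1 b.2)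
          ≤ B₈ * (bondNorm L m (ι a).η (-(3 : ℝ)) (ι a).Ω (fun x μ => Jcur (ι a).η U₀ A' μ x)
          + wsup 1 (fun q : {q : ℕ × (Site d × Fin d) // q.1 ≤ m ∧ q.2 ∈ towerBondsP L (ι a).Ω ((ι a).Λs m) q.1} =>
          linCovIter L U₀ (iEta (ι a).η A') q.1.1 q.1.2.1 q.1.2.2)) + γ' * B₀ * (α₀ + α₁) ∧
        msup L m (ι a).η (-(2 : ℝ)) (fun j (t : Fin d × Fin d × Site d) => SideTouches ((ι a).Ω j) t.2.2 t.2.1)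
          (fun t => covDerivFwd (ι a).η U₀ t.1 (fun z => A' z t.2.1) t.2.2)
          ≤ B₈ * (bondNorm L m (ι a).η (-(3 : ℝ)) (ι a).Ω (fun x μ => Jcur (ι a).η U₀ A' μ x)
          + wsup 1 (fun q : {q : ℕ × (Site d × Fin d) // q.1 ≤ m ∧ q.2 ∈ towerBondsP L (ι a).Ω ((ι a).Λs m) q.1} =>
          linCovIter L U₀ (iEta (ι a).η A') q.1.1 q.1.2.1 q.1.2.2)) + γ' * B₀ * (α₀ + α₁) := by
    intro A' hA'p hsa' hWA' hA0'
    have hbig : ∀ j, j ≤ m → ∀ (y : Site d) (τ : Fin d), SideTouches ((ι a).Ω j) y τ →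
        U₁ y τ = cfgExp (ι a).η A' y τ ∧ ‖A' y τ‖ ≤ (2 * (L * (5 * (d : ℝ) * L * B₈ * (α₀ + α₁))) +
          8 * (8 * B₀' * (5 * (d : ℝ) * L * B₈) * (α₀ + α₁))) * ((L : ℝ) ^ j * (ι a).η)⁻¹ := by
      intro j hj y τ hsd
      obtain ⟨he, hb⟩ := hWA' j hj y τ hsd
      refine ⟨he, hb.trans (mul_le_mul_of_nonneg_right ?_ (by positivity))⟩
      have h1 : (1 : ℝ) * (5 * (d : ℝ) * L * B₈ * (α₀ + α₁)) ≤ L * (5 * (d : ℝ) * L * B₈ * (α₀ + α₁)) :=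
        mul_le_mul_of_nonneg_right hLr hcs0
      have h2 : 0 ≤ 8 * (8 * B₀' * (5 * (d : ℝ) * L * B₈) * (α₀ + α₁)) := by positivity
      linarith only [h1, h2, hcs0]
    obtain ⟨h1, h2⟩ := SH59 a α₀ α₁ hα₀ hα₁ hs U₀ U' hU₀ hU' hU₀p hU'p φ ⟨⟨⟨hInR, hφsa, hφoff, hBdd⟩, hφp⟩, hφn⟩ h33 h34 hAx h135 h66 m hm1 hmk.le
      u₁ U₁ A' hu₁ hu₁p hU₁p hA'p hW h129 hLan hsa' hbig hA0'
    have hX : 0 ≤ bondNorm L m (ι a).η (-(3 : ℝ)) (ι a).Ω (fun x μ => Jcur (ι a).η U₀ A' μ x)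
        + wsup 1 (fun q : {q : ℕ × (Site d × Fin d) // q.1 ≤ m ∧ q.2 ∈ towerBondsP L (ι a).Ω ((ι a).Λs m) q.1} =>
          linCovIter L U₀ (iEta (ι a).η A') q.1.1 q.1.2.1 q.1.2.2) := by
      have ha : 0 ≤ bondNorm L m (ι a).η (-(3 : ℝ)) (ι a).Ω (fun x μ => Jcur (ι a).η U₀ A' μ x) := by
        unfold bondNorm; exact msup_nonneg L m (ι a).hη.le _ _ _
      have hb := wsup_nonneg zero_le_one (fun q : {q : ℕ × (Site d × Fin d) // q.1 ≤ m ∧ q.2 ∈ towerBondsP L (ι a).Ω ((ι a).Λs m) q.1} =>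
        linCovIter L U₀ (iEta (ι a).η A') q.1.1 q.1.2.1 q.1.2.2)
      linarith only [ha, hb]
    have hmono := mul_le_mul_of_nonneg_right hB₀8 hX
    exact ⟨h1.trans (by linarith only [hmono]), h2.trans (by linarith only [hmono])⟩
  -- `c_{DA} = 2dL²c⋆ ≥ dL²(c⋆ + 2γ′B₀(α₀ + α₁))` since `2γ′B₀ ≤ 5dLB₈`
  have hcDAlo : (d : ℝ) * (L : ℝ) ^ 2 * (5 * (d : ℝ) * L * B₈ * (α₀ + α₁) + 2 * (γ' * B₀ * (α₀ + α₁))) ≤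
      2 * (d : ℝ) * (L : ℝ) ^ 2 * (5 * (d : ℝ) * L * B₈ * (α₀ + α₁)) := by
    have h1 : 2 * (γ' * B₀ * (α₀ + α₁)) ≤ 5 * (d : ℝ) * L * B₈ * (α₀ + α₁) := by
      have h := mul_le_mul_of_nonneg_right hγB hsum.le
      linarith only [h]
    have h2 : (0 : ℝ) ≤ (d : ℝ) * (L : ℝ) ^ 2 := by positivity
    have h3 := mul_le_mul_of_nonneg_left h1 h2
    linarith only [h3]
  -- EDITION γ′: the Λb-generic γ′ body INSTANTIATED AT PRINT's CLASS `towerBondsP L (ι a).Ω ((ι a).Λs m) ·` with the member's own tower laws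
  -- (`B8TowerBondsPrinted.ZdIdx.towerBondsP_laws (ι a)`: box law «box ⊂ Ω_{j−1}», class disjuncts) — T5 :219–:221's device; `htw a m` for `htowm`
  exact sP5_body_of_join_src_γ'_per hd2 hL (ι a).hη (p a) (ι a).hΩ (B8TowerBondsPrinted.ZdIdx.towerBondsP_laws (ι a)).1
    (B8TowerBondsPrinted.ZdIdx.towerBondsP_laws (ι a)).2 hm1 hmk (htw a (m + 1) hmk) (hlt a m hmk) (htop a m hmk) (htw a m hmk.le)
    hα₀ hα₁ hB₈ hB₀' rfl rfl hU₀ hU' hU₀p h33 h34 hAx h135 hu₁ hu₁p hAp hW h129 hInR hmf hf hfsa hφp hLan hdat hSg SH59m hside hC₂L h61L hsmall₁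
    g Δ q qs Aw c g_rightΩ c_range (fun j hj => hdiv a j (by omega)) (fun j hj => hΛ a (m + 1) hmk j hj) (fun j hj => hΩp a j (by omega))
    hGper hqcq_per hΔ hqs hq H' hB₀'H hB₂' hBG hBR hH0 hH1 hH2 hHsupp hHequiv hHper hQH hG hGsupp hGreal hRbd hRreal
    le_rfl le_rfl hcDAlo hα3 hα4 hsmall hc₃ hsc hα₃' hs₁ hs₂ hs₃ hs₄ hs₅ hs₆ hs₇ hsm hprod8 rfl rfl rfl rfl hcA' ha₁' hb₁' hθ hα3L hα4L hsmallL
    h103 h106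

/-- ★★★ **pub-ymgap T5's GUARDED SOCKET `SP5base` :117–:130 (PROPOSITION 5, EXISTENCE AT LEVEL `1` FROM `u₁ = 1`, `U₁ = U′`, p. 89; PERIODIC ARGUMENTS,
NESTED `P`-PERIODIC MEMBERS) — THE BINDER TEXT VERBATIM at instance (ii) (`LanF146 … φ`, T6c's admissibility text)**, from the same displayed data as
`sockP5SrcPer_of_lettersAtPerNested` minus `SH59` plus `2 ≤ 5dLB₈` («B₁ not too small», p. 89).  PROOF: letters at `n := 1`, windows, source data, E-ii-4a's
`sP5base_body_of_join_src_per`.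
[cite: Balaban1985RegularSpaces, Prop. 5 (1.107)–(1.108) p.94, p.89, (1.66) p.88, Thm 4 p.88, Thm 8 (1.146) p.101, (1.29) p.81, p.77 («Ω_j ⊂ T_η»); Balaban1985BackgroundPropagators, Thm 3.1 p.397, (3.19) p.393] -/
theorem sockP5baseSrcPer_of_lettersAtPerNested (hd2 : 2 ≤ d) {L : ℕ} (hL : 2 ≤ L)
    {B₀' B₈ cP γ B₀'H B₂' BG BR : ℝ}
    (hB₀' : 0 < B₀') (hB₈ : 0 < B₈) (hB₀'H : 0 < B₀'H) (hB₂' : 0 ≤ B₂') (hBG : 0 ≤ BG) (hBR : 0 ≤ BR) (hγ : 0 ≤ γ)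
    {J : Type*} (ι : J → ZdIdx d L) (p : J → ℕ)
    -- PER-MEMBER LAWS (displayed): towers «Bʲ(y) ⊂ Ω_j» at every truncation (only truncation `1` is read),
    -- the torus data `Lʲ ∣ P`, `Λ_j^{(m)}` shift-invariant, `Ω_j` `P`-periodic (print's «Ω_j ⊂ T_η», p. 77)
    (htw : ∀ a : J, ∀ m, m ≤ (ι a).k → ∀ j, j ≤ m → ∀ y ∈ (ι a).Λs m j, ∀ x, InBox (tlo L y j) (thi L y j) x → x ∈ (ι a).Ω j)
    (hdiv : ∀ a : J, ∀ j, j ≤ (ι a).k → ((L : ℤ) ^ j ∣ (p a : ℤ)))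
    (hΛ : ∀ a : J, ∀ m, m ≤ (ι a).k → ∀ j, j ≤ m → ∀ (y : Site d) (i : Fin d),
      y + ((p a : ℤ) / (L : ℤ) ^ j) • e i ∈ (ι a).Λs m j ↔ y ∈ (ι a).Λs m j)
    (hΩp : ∀ a : J, ∀ j, j ≤ (ι a).k → IsPeriodic (p a) (fun x : Site d => x ∈ (ι a).Ω j))
    (hB : 2 ≤ 5 * (d : ℝ) * L * B₈)
    -- THE [4] LETTERS AT NESTED `Ω_j` (displayed supplier; N06's periodic Green's-function line)
    (hLet : ∀ a : J, ∀ α₀ : ℝ, 0 < α₀ → ∀ U₀ : Site d → Fin d → 𝔸ˣ, (∀ x κ, U₀ x κ ∈ unitaryUnits 𝔸) → IsPeriodic (p a) U₀ →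
      InAk L (ι a).k (ι a).η α₀ (ι a).Ω U₀ → ∀ n, 1 ≤ n → n ≤ (ι a).k →
      ∃ (g Δ : (Site d → 𝔸) →ₗ[ℂ] (Site d → 𝔸)) (q : (Site d → 𝔸) →ₗ[ℂ] (ℕ → Site d → 𝔸)) (qs : (ℕ → Site d → 𝔸) →ₗ[ℂ] (Site d → 𝔸))
        (Aw c : (ℕ → Site d → 𝔸) →ₗ[ℂ] (ℕ → Site d → 𝔸)) (H' : XSpace d n 𝔸 →ₗ[ℂ] (Site d → 𝔸)),
        (∀ x, (∀ (z : Site d) (i : Fin d), x (z + (p a : ℤ) • e i) = x z) → ∀ y ∈ (ι a).Ω 0, (Δ (g x) + qs (Aw (q (g x)))) y = x y) ∧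
        (∀ f, (∀ (z : Site d) (i : Fin d), f (z + (p a : ℤ) • e i) = f z) → q (g (g (qs (c (q f))))) = q f) ∧
        (∀ (f : Site d → 𝔸) (z : Site d) (i : Fin d), g f (z + (p a : ℤ) • e i) = g f z) ∧
        (∀ f : Site d → 𝔸, (∀ (z : Site d) (i : Fin d), f (z + (p a : ℤ) • e i) = f z) →
      ∀ (z : Site d) (i : Fin d), qs (c (q f)) (z + (p a : ℤ) • e i) = qs (c (q f)) z) ∧
        (∀ (f : Site d → 𝔸), ∀ x ∈ (ι a).Ω 0, Δ f x = covLap (ι a).η U₀ (((ι a).Ω 0).indicator f) x) ∧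
        (∀ (μ : ℕ → Site d → 𝔸), ∀ x ∈ (ι a).Ω 0, qs μ x = QT L n ((ι a).Λs n) U₀ μ x) ∧
        (∀ (f : Site d → 𝔸) (j : ℕ), j ≤ n → ∀ y ∈ (ι a).Λs n j, q f j y = QprimeIter (zdBlocking d L) (bgT L U₀) j f y) ∧
        (∀ (X : XSpace d n 𝔸) (x : Site d), ‖H' X x‖ ≤ B₀'H * ‖X‖) ∧
        (∀ j, j ≤ n → ∀ (X : XSpace d n 𝔸), ∀ b ∈ {b : Site d × Fin d | SideTouches ((ι a).Ω j) b.1 b.2},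
      wt L (ι a).η j * ‖covDerivFwd (ι a).η U₀ b.2 (H' X) b.1‖ ≤ B₀'H * ‖X‖) ∧
        (∀ X : XSpace d n 𝔸, Bd2 L (ι a).η n (ι a).Ω (covLap (ι a).η U₀ (H' X)) (B₂' * ‖X‖)) ∧
        (∀ (X : XSpace d n 𝔸) (x : Site d), x ∉ (ι a).Ω 0 → H' X x = 0) ∧
        (∀ X Y : XSpace d n 𝔸, (∀ b, Y b = -star (X b)) → ∀ x, H' Y x = -star (H' X x)) ∧
        (∀ X : XSpace d n 𝔸, (∀ (b : Fin (n + 1) × Site d) (i : Fin d), X (b.1, b.2 + ((p a : ℤ) / (L : ℤ) ^ (b.1 : ℕ)) • e i) = X b) →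
      ∀ (z : Site d) (i : Fin d), H' X (z + (p a : ℤ) • e i) = H' X z) ∧
        (∀ (Y : XSpace d n 𝔸), (∀ (b : Fin (n + 1) × Site d) (i : Fin d), Y (b.1, b.2 + ((p a : ℤ) / (L : ℤ) ^ (b.1 : ℕ)) • e i) = Y b) →
      ∀ (j : ℕ) (hj : j ≤ n) (y : Site d), y ∈ (ι a).Λs n j →
      QprimeIter (zdBlocking d L) (bgT L U₀) j (H' Y) y = Y (⟨j, Nat.lt_succ_of_le hj⟩, y)) ∧
        (∀ (f : Site d → 𝔸) (r : ℝ), 0 ≤ r → Bd2 L (ι a).η n (ι a).Ω f r →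
      (∀ x, ‖g f x‖ ≤ BG * r) ∧ ∀ j, j ≤ n → ∀ b ∈ {b : Site d × Fin d | SideTouches ((ι a).Ω j) b.1 b.2},
        wt L (ι a).η j * ‖covDerivFwd (ι a).η U₀ b.2 (g f) b.1‖ ≤ BG * r) ∧
        (∀ (f : Site d → 𝔸) (x : Site d), x ∉ (ι a).Ω 0 → g f x = 0) ∧
        (∀ f : Site d → 𝔸, (∀ j, j ≤ n → ∀ x ∈ (ι a).Ω j, IsSelfAdjoint (f x)) → ∀ x, IsSelfAdjoint (g f x)) ∧
        (∀ (f : Site d → 𝔸) (r : ℝ), 0 ≤ r → Bd2 L (ι a).η n (ι a).Ω f r → Bd2 L (ι a).η n (ι a).Ω (f - g (qs (c (q (g f))))) (BR * r)) ∧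
        (∀ f : Site d → 𝔸, (∀ j, j ≤ n → ∀ x ∈ (ι a).Ω j, IsSelfAdjoint (f x)) →
      ∀ j, j ≤ n → ∀ x ∈ (ι a).Ω j, IsSelfAdjoint ((f - g (qs (c (q (g f))))) x)))
    -- THE JOIN's SCALAR WINDOWS BELOW `cP`, SOURCED (displayed; (1.103)∕(1.106) at `hE₂ + γ(α₀ + α₁)∕2`)
    (hwin : ∀ α₀ α₁ : ℝ, 0 < α₀ → 0 < α₁ → α₀ + α₁ ≤ cP → ∀ cs α₄ cB cDA hE hE₂ lE lE₂ : ℝ,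
      cs = 5 * (d : ℝ) * L * B₈ * (α₀ + α₁) → α₄ = 8 * B₀' * (5 * (d : ℝ) * L * B₈) * (α₀ + α₁) →
      cB = L * cs → cDA = 2 * (d : ℝ) * (L : ℝ) ^ 2 * cs →
      hE = B₀'H * (C2p d * (40 * d * cB + α₄) * α₄) → hE₂ = B₂' * (C2p d * (40 * d * cB + α₄) * α₄) →
      lE = B₀'H * (4 * C2p d * (40 * d * cB + 2 * α₄)) → lE₂ = B₂' * (4 * C2p d * (40 * d * cB + 2 * α₄)) →
      36 * d * B₈ * cs ≤ 1 / 2 ∧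
      8 * (131072 * ((d : ℝ) + 1) ^ 2) * Real.exp (4 * (800 * ((d : ℝ) + 1) ^ 2 * ((d : ℝ) + 4)) * α₀) ≤ 16 * (131072 * ((d : ℝ) + 1) ^ 2) ∧
      2 * cs ^ 2 + 20 * d * α₀ * cs + 2 * (16 * (131072 * ((d : ℝ) + 1) ^ 2)) * cs ^ 2 ≤ α₀ + α₁ ∧
      (d : ℝ) * L * α₁ ≤ 1 / 8 ∧
      C0 d * α₀ ≤ 1 / 3 ∧ 4 * α₀ ≤ c2' d L ∧
      Real.exp (4 * (800 * ((d : ℝ) + 1) ^ 2 * ((d : ℝ) + 4)) * α₀) * (1 + 8 * (131072 * ((d : ℝ) + 1) ^ 2) * cB) ≤ 2 ∧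
      2 * cB ≤ c3 d L ∧ 2048 * (d : ℝ) * cB ≤ 1 ∧ 40 * d * cB ≤ 1 / 200 ∧
      200 * C6 d * (2 * α₄) ≤ 1 ∧ 12000 * ((d : ℝ) + 1) * L * (2 * α₄) ≤ 1 ∧
      C4G d L * (α₀ + 40 * d * cB + 4 * (2 * α₄)) ≤ 1 ∧
      1024 * ((d : ℝ) + 1) * ((d : ℝ) + 4) * L ^ 2 * α₀ ≤ 1 ∧ 32 * ((d : ℝ) + 1) ^ 2 * C6 d * L ^ 2 * α₀ ≤ 1 ∧
      16 * d * C5' d * C6 d * (L : ℝ) ^ 2 * α₀ ≤ 1 ∧ 8 * d * C6 d * L * α₀ ≤ 1 ∧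
      40 * d * cB + α₄ ≤ 1 / (4 * B₀'H * (2 * C2p d)) ∧ 2 * C6 d * (40 * d * cB + 4 * α₄) ≤ 1 / 8 ∧
      cB ≤ 1 / 13 ∧ α₄ / 4 + hE ≤ 1 / 24 ∧ α₄ / 4 + hE ≤ 1 / 140 ∧ 10 * (α₄ / 4 + hE) * BR ≤ 1 / 2 ∧
      BG * Mc d BR (α₄ / 4 + hE) cB (hE₂ + γ * (α₀ + α₁) / 2) cDA ≤ α₄ / 4 ∧
      BG * Kc d BR (α₄ / 4 + hE) cB (hE₂ + γ * (α₀ + α₁) / 2) cDA lE₂ (1 + lE) (1 + lE) ≤ 1 / 2) :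
    ∀ a : J, ∀ α₀ α₁ : ℝ, 0 < α₀ → 0 < α₁ → α₀ + α₁ ≤ cP →
      ∀ U₀ U' : Site d → Fin d → 𝔸ˣ, (∀ x κ, U₀ x κ ∈ unitaryUnits 𝔸) → (∀ x κ, U' x κ ∈ unitaryUnits 𝔸) →
      IsPeriodic (p a) U₀ → IsPeriodic (p a) U' → ∀ φ : Site d → 𝔸, (((InR138 L (ι a).k (ι a).η ((ι a).Ω 0) ((ι a).Λs (ι a).k) U₀ φ ∧ (∀ x, IsSelfAdjoint (φ x)) ∧ (∀ x, x ∉ (ι a).Ω 0 → φ x = 0) ∧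
          Bdd L (ι a).k (ι a).η (-(2 : ℝ)) (fun j (x : Site d) => x ∈ (ι a).Ω j) φ) ∧ IsPeriodic (p a) φ) ∧
        msup L (ι a).k (ι a).η (-(2 : ℝ)) (fun j (x : Site d) => x ∈ (ι a).Ω j) φ < γ * (α₀ + α₁)) →
      InAk L (ι a).k (ι a).η α₀ (ι a).Ω U₀ → InAk L (ι a).k (ι a).η α₀ (ι a).Ω (mulCfg U' U₀) → (∀ m, m ≤ (ι a).k → InAx L m ((ι a).Λs m) U₀ (mulCfg U' U₀)) →
      (∀ j, j ≤ (ι a).k → ∀ (z : Site d) (μ : Fin d),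
        ((∀ x, InBox (tlo L z j) (thi L z j) x → x ∈ (ι a).Ω j) ∨ (∀ x, InBox (tlo L (z + e μ) j) (thi L (z + e μ) j) x → x ∈ (ι a).Ω j)) →
        ‖(avgIter L (mulCfg U' U₀) j z μ : 𝔸) - (avgIter L U₀ j z μ : 𝔸)‖ ≤ α₁) →
      (∀ b ∈ {b : Site d × Fin d | SideTouches ((ι a).Ω 0) b.1 b.2}, ‖((U' b.1 b.2 : 𝔸ˣ) : 𝔸) - 1‖ ≤ α₁) →
      (∃ (v : Site d → 𝔸ˣ) (lam : Site d → 𝔸), (∀ x, v x ∈ unitaryUnits 𝔸) ∧ (∀ x, x ∉ (ι a).Ω 0 → v x = 1) ∧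
        (∀ j, j ≤ 1 → ∀ b ∈ {b : Site d × Fin d | SideTouches ((ι a).Ω j) b.1 b.2}, (v b.1 : 𝔸) = ((gaugeExp lam b.1 : 𝔸ˣ) : 𝔸) ∧
        (v (b.1 + e b.2) : 𝔸) = ((gaugeExp lam (b.1 + e b.2) : 𝔸ˣ) : 𝔸)) ∧
        (∀ j, j ≤ 1 → ∀ b ∈ {b : Site d × Fin d | SideTouches ((ι a).Ω j) b.1 b.2},
        ‖lam b.1‖ ≤ (8 * B₀' * (5 * (d : ℝ) * L * B₈) * (α₀ + α₁)) ∧ ((L : ℝ) ^ j * (ι a).η) * ‖covDerivFwd (ι a).η U₀ b.2 lam b.1‖ ≤ (8 * B₀' * (5 * (d : ℝ) * L * B₈) * (α₀ + α₁))) ∧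
        LanF146 L (ι a).k (ι a).η ((ι a).Ω 0) (ι a).Λs U₀ φ 1 (mgauge U₀ v⁻¹ U') ∧ Restr129 L 1 ((ι a).Λs 1) U₀ ((1 : Site d → 𝔸ˣ) * v) ∧
        IsPeriodic (p a) v) := by
  intro a α₀ α₁ hα₀ hα₁ hs U₀ U' hU₀ hU' hU₀p hU'p φ hAdm h33 h34 hAx _h135 h66
  obtain ⟨⟨⟨hInR, hφsa, -, hBdd⟩, hφp⟩, hφn⟩ := hAdm
  obtain ⟨g, Δ, q, qs, Aw, c, H', g_rightΩ, c_range, hGper, hqcq_per, hΔ, hqs, hq, hH0, hH1, hH2, hHsupp, hHequiv, hHper, hQH, hG, hGsupp, hGreal, hRbd, hRreal⟩ :=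
    hLet a α₀ hα₀ U₀ hU₀ hU₀p h33 1 le_rfl (ι a).hk
  obtain ⟨hside, hC₂, h61, hsmall₁, hα3, hα4, hsmall, hc₃, hsc, hα₃', hs₁, hs₂, hs₃, hs₄, hs₅, hs₆, hs₇, hsm, hprod8, hcA', ha₁', hb₁', hθ, h103, h106⟩ :=
    hwin α₀ α₁ hα₀ hα₁ hs _ _ _ _ _ _ _ _ rfl rfl rfl rfl rfl rfl rfl rfl
  -- the source: size `γ(α₀ + α₁)` on `Ω₀ ⊇ Ω₁`, Hermitian, periodic
  have hmf : 0 ≤ γ * (α₀ + α₁) := by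
    have : 0 ≤ α₀ + α₁ := by linarith
    positivity
  have hf : Bd2 L (ι a).η 1 (ι a).Ω φ (γ * (α₀ + α₁)) := by
    intro j hj x hx
    have h := weight_mul_norm_le_msup hBdd (hj.trans (ι a).hk) (i := x) hx
    have e2 : (-(2 : ℝ)) = -((2 : ℕ) : ℝ) := by norm_num
    rw [e2, weight_neg_natCast L (ι a).η 2 j] at h
    have hw : wt L (ι a).η j ^ 2 = ((L : ℝ) ^ j * (ι a).η) ^ 2 := rfl
    rw [hw]
    rw [e2] at hφn
    exact h.trans hφn.le
  have hfsa : ∀ j, j ≤ 1 → ∀ x ∈ (ι a).Ω j, IsSelfAdjoint (φ x) := fun _ _ x _ => hφsa x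
  exact sP5base_body_of_join_src_per hd2 hL (ι a).hη (p a) (ι a).hk (ι a).hΩ (htw a 1 (ι a).hk) hα₀ hα₁ hB₈ hB₀' hB rfl rfl hU₀ hU' hU₀p hU'p
    h33 h34 hAx h66 hInR hmf hf hfsa hφp g Δ q qs Aw c g_rightΩ c_range (fun j hj => hdiv a j (hj.trans (ι a).hk)) (fun j hj => hΛ a 1 (ι a).hk j hj)
    (hΩp a 0 (Nat.zero_le _)) hGper hqcq_per hΔ hqs hq H' hB₀'H hB₂' hBG hBR hH0 hH1 hH2 hHsupp hHequiv hHper hQH hG hGsupp hGreal hRbd hRreal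
    le_rfl le_rfl le_rfl hα3 hα4 hsmall hc₃ hsc hα₃' hs₁ hs₂ hs₃ hs₄ hs₅ hs₆ hs₇ hsm hprod8 rfl rfl rfl rfl hcA' ha₁' hb₁' hθ h103 h106

#print axioms sockP5SrcPer_of_lettersAtPerNested
#print axioms sockP5baseSrcPer_of_lettersAtPerNested

end Sockets

end Literature.MathematicalPhysics.QuantumFieldTheory.Balaban1983to89.B8Prop5NestedServerSrcPer

end
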